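import Mathlib

/-!
# Convolution contracts the `B`-energy: the Fourier input for theta-body kernels (support file)

Crux `stmt-MatrixMultiplication-14309` (`FourierTwoFamiliesModP.PrimeCyclicPowerGain`), line
`clique-coclique-direct-sum-clique`, milestone 5 of the bet `stub_thetaBound`; closes the registered milestone
stub `stub_thetaConvolutionBound`, the one harmonic-analysis input of the programme (it feeds the
`ϑ`-CommonFrequencyBias milestone `stub_thetaFrequencyBias`).

Setting: a finite additive commutative group `G` with its complex characters `ψ : AddChar G ℂ`, a finite index
type `W`, a real kernel `B : W → W → ℝ` which is positive semidefinite as a REAL quadratic form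
(`0 ≤ Σ_{w,w'} x w · B w w' · x w'` for every real vector `x`, a raw double `Finset.univ` sum), real functions
`h w : G → ℝ` (`w : W`) and `θ : G → ℝ`, and a bound `M` on the character sums of `θ`:
`‖Σ_x θ x · ψ x‖ ≤ M` for every `ψ`.

Claim (`conv_energy_le`, `stub_thetaConvolutionBound`): with `(θ ∗ f)(y) = Σ_x θ x · f (y − x)`,
`Σ_{w,w'} B w w' · Σ_y (θ ∗ h_w)(y) (θ ∗ h_{w'})(y) ≤ M² · Σ_{w,w'} B w w' · Σ_y h_w(y) h_{w'}(y)`.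

Proof (all sums finite; the identities are proved in `ℂ`, real parts are taken at the very end).  Write
`f̂ ψ = Σ_y f y · ψ y`.
* `sum_conj_apply_mul_apply`, `sum_conj_ft_mul_ft` (orthogonality, Plancherel):
  `Σ_ψ conj (f̂ ψ) · ĝ ψ = |G| · Σ_y conj (f y) · g y`, from Mathlib's `AddChar.sum_apply_eq_ite`
  (`Σ_ψ ψ a = |G| · [a = 0]`) and `AddChar.map_neg_eq_conj` (`ψ (−y) = conj (ψ y)`);
* `ft_conv` (convolution theorem): `(θ ∗ f)^ ψ = θ̂ ψ · f̂ ψ` (swap the sums, reindex `y ↦ y + x`);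
* `re_quad_conj_nonneg`: a real PSD form is Hermitian-PSD on complex vectors,
  `0 ≤ re Σ_{w,w'} B w w' · conj (z w) · z w'` (split `z` into real and imaginary parts: the real part is
  `aᵀBa + bᵀBb`);
* `energy_eq_sum`, `energy_eq_re_sum` (the `B`-energy on the Fourier side): for real `F w : G → ℝ`,
  `|G| · Σ_{w,w'} B w w' Σ_y F_w y · F_{w'} y = Σ_ψ q_F ψ`, `q_F ψ = Σ_{w,w'} B w w' · conj (F̂_w ψ) · F̂_{w'} ψ`;
* `quad_ft_conv`: by the convolution theorem `q_{θ∗h} ψ = ‖θ̂ ψ‖² · q_h ψ`.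
Assembly (`conv_energy_le`): `|G| · LHS = Σ_ψ ‖θ̂ ψ‖² · re q_h ψ ≤ M² · Σ_ψ re q_h ψ = M² · |G| · RHS`, using
`0 ≤ re q_h ψ` and `‖θ̂ ψ‖² ≤ M²`; divide by `|G| > 0`.  The symmetry hypothesis carried by the stub is not
needed (positivity of the real quadratic form alone makes `re q_h ψ ≥ 0`) and is not used.
-/

namespace Summit.MatrixMultiplication.MatrixMultiplication.Theorems.PrimeCyclicPowerGainTheta.Convolution

open scoped BigOperators ComplexConjugate

section Fourier

variable {G : Type*} [AddCommGroup G] [Fintype G]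

/-- **Orthogonality of characters, two-point form**: `Σ_ψ conj (ψ y) · ψ y' = |G| · [y' = y]`. -/
theorem sum_conj_apply_mul_apply [DecidableEq G] (y y' : G) :
    ∑ ψ : AddChar G ℂ, conj (ψ y) * ψ y' = if y' = y then (Fintype.card G : ℂ) else 0 := by
  have h : ∀ ψ : AddChar G ℂ, conj (ψ y) * ψ y' = ψ (y' - y) := by
    intro ψ
    rw [← AddChar.map_neg_eq_conj, ← AddChar.map_add_eq_mul, neg_add_eq_sub]
  rw [Finset.sum_congr rfl fun ψ _ => h ψ, AddChar.sum_apply_eq_ite]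
  exact if_congr sub_eq_zero rfl rfl

/-- **Plancherel** (unnormalised, sesquilinear form): `Σ_ψ conj (f̂ ψ) · ĝ ψ = |G| · Σ_y conj (f y) · g y`,
where `f̂ ψ = Σ_y f y · ψ y`. -/
theorem sum_conj_ft_mul_ft (f g : G → ℂ) :
    ∑ ψ : AddChar G ℂ, conj (∑ y, f y * ψ y) * (∑ y, g y * ψ y) =
      (Fintype.card G : ℂ) * ∑ y, conj (f y) * g y := by
  classical
  have h1 : ∀ ψ : AddChar G ℂ, conj (∑ y, f y * ψ y) * (∑ y, g y * ψ y) =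
      ∑ y, ∑ y', conj (f y) * g y' * (conj (ψ y) * ψ y') := by
    intro ψ
    rw [map_sum, Finset.sum_mul]
    refine Finset.sum_congr rfl fun y _ => ?_
    rw [Finset.mul_sum]
    refine Finset.sum_congr rfl fun y' _ => ?_
    rw [map_mul]
    ring
  have h2 : ∀ y y' : G, ∑ ψ : AddChar G ℂ, conj (f y) * g y' * (conj (ψ y) * ψ y') =
      if y' = y then (Fintype.card G : ℂ) * (conj (f y) * g y') else 0 := by
    intro y y'
    rw [← Finset.mul_sum, sum_conj_apply_mul_apply]
    split_ifs <;> ring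
  rw [Finset.sum_congr rfl fun ψ _ => h1 ψ, Finset.sum_comm, Finset.mul_sum]
  refine Finset.sum_congr rfl fun y _ => ?_
  rw [Finset.sum_comm, Finset.sum_congr rfl fun y' _ => h2 y y']
  simp only [Finset.sum_ite_eq', Finset.mem_univ, if_true]

/-- **Convolution theorem**: the transform of `y ↦ Σ_x θ x · f (y − x)` at `ψ` is `θ̂ ψ · f̂ ψ`. -/
theorem ft_conv (θ f : G → ℂ) (ψ : AddChar G ℂ) :
    ∑ y, (∑ x, θ x * f (y - x)) * ψ y = (∑ x, θ x * ψ x) * ∑ y, f y * ψ y := by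
  calc ∑ y, (∑ x, θ x * f (y - x)) * ψ y
      = ∑ y, ∑ x, θ x * f (y - x) * ψ y := by simp_rw [Finset.sum_mul]
    _ = ∑ x, ∑ y, θ x * f (y - x) * ψ y := Finset.sum_comm
    _ = ∑ x, θ x * ψ x * ∑ y, f y * ψ y := by
        refine Finset.sum_congr rfl fun x _ => ?_
        rw [Finset.mul_sum]
        refine Fintype.sum_equiv (Equiv.subRight x) _ _ fun y => ?_
        have hψ : ψ y = ψ (y - x) * ψ x := by rw [← AddChar.map_add_eq_mul, sub_add_cancel]
        rw [Equiv.subRight_apply, hψ]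
        ring
    _ = (∑ x, θ x * ψ x) * ∑ y, f y * ψ y := by rw [Finset.sum_mul]

/-- Pulling a common factor through a conjugate pair: `b · conj (t u) · (t v) = ‖t‖² · (b · conj u · v)`. -/
theorem mul_conj_mul_mul (b t u v : ℂ) :
    b * conj (t * u) * (t * v) = ((‖t‖ ^ 2 : ℝ) : ℂ) * (b * conj u * v) := by
  rw [map_mul, Complex.ofReal_pow, ← Complex.conj_mul']
  ring

end Fourier

section Positivity

variable {W : Type*} [Fintype W]

/-- **A real PSD form is Hermitian-PSD on complex vectors**: `0 ≤ re Σ_{w,w'} B w w' · conj (z w) · z w'`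
whenever `0 ≤ Σ_{w,w'} x w · B w w' · x w'` for all real `x`.  Writing `z = a + i b`, the real part equals
`aᵀBa + bᵀBb` (symmetry of `B` is not needed). -/
theorem re_quad_conj_nonneg (B : W → W → ℝ)
    (hpsd : ∀ x : W → ℝ, 0 ≤ ∑ w, ∑ w', x w * B w w' * x w') (z : W → ℂ) :
    0 ≤ (∑ w, ∑ w', (B w w' : ℂ) * conj (z w) * z w').re := by
  have hre : (∑ w, ∑ w', (B w w' : ℂ) * conj (z w) * z w').re =
      ∑ w, ∑ w', (z w).re * B w w' * (z w').re + ∑ w, ∑ w', (z w).im * B w w' * (z w').im := by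
    rw [Complex.re_sum, ← Finset.sum_add_distrib]
    refine Finset.sum_congr rfl fun w _ => ?_
    rw [Complex.re_sum, ← Finset.sum_add_distrib]
    refine Finset.sum_congr rfl fun w' _ => ?_
    simp only [Complex.mul_re, Complex.mul_im, Complex.conj_re, Complex.conj_im,
      Complex.ofReal_re, Complex.ofReal_im]
    ring
  rw [hre]
  exact add_nonneg (hpsd _) (hpsd _)

/-- Weighted comparison of sums: if `t i ≤ C` and `0 ≤ r i` on `s` then `Σ t i · r i ≤ C · Σ r i`. -/
theorem sum_mul_le_of_le {ι : Type*} (s : Finset ι) (t r : ι → ℝ) (C : ℝ)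
    (ht : ∀ i ∈ s, t i ≤ C) (hr : ∀ i ∈ s, 0 ≤ r i) :
    ∑ i ∈ s, t i * r i ≤ C * ∑ i ∈ s, r i := by
  rw [Finset.mul_sum]
  exact Finset.sum_le_sum fun i hi => mul_le_mul_of_nonneg_right (ht i hi) (hr i hi)

end Positivity

section Energy

variable {G : Type*} [AddCommGroup G] [Fintype G] {W : Type*} [Fintype W]

/-- **The `B`-energy on the Fourier side** (Plancherel termwise): for real functions `F w : G → ℝ`,
`|G| · Σ_{w,w'} B w w' Σ_y F_w y · F_{w'} y = Σ_ψ Σ_{w,w'} B w w' · conj (F̂_w ψ) · F̂_{w'} ψ` in `ℂ`. -/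
theorem energy_eq_sum (B : W → W → ℝ) (F : W → G → ℝ) :
    (((Fintype.card G : ℝ) * ∑ w, ∑ w', B w w' * ∑ y, F w y * F w' y : ℝ) : ℂ) =
      ∑ ψ : AddChar G ℂ, ∑ w, ∑ w', (B w w' : ℂ) * conj (∑ y, (F w y : ℂ) * ψ y) *
        (∑ y, (F w' y : ℂ) * ψ y) := by
  have key : ∀ w w' : W,
      ∑ ψ : AddChar G ℂ, (B w w' : ℂ) * conj (∑ y, (F w y : ℂ) * ψ y) * (∑ y, (F w' y : ℂ) * ψ y) =
        (Fintype.card G : ℂ) * ((B w w' : ℂ) * ∑ y, (F w y : ℂ) * (F w' y : ℂ)) := by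
    intro w w'
    have h := sum_conj_ft_mul_ft (fun y => (F w y : ℂ)) (fun y => (F w' y : ℂ))
    simp only [Complex.conj_ofReal] at h
    calc ∑ ψ : AddChar G ℂ, (B w w' : ℂ) * conj (∑ y, (F w y : ℂ) * ψ y) * (∑ y, (F w' y : ℂ) * ψ y)
        = (B w w' : ℂ) *
            ∑ ψ : AddChar G ℂ, conj (∑ y, (F w y : ℂ) * ψ y) * (∑ y, (F w' y : ℂ) * ψ y) := by
          rw [Finset.mul_sum]
          exact Finset.sum_congr rfl fun ψ _ => mul_assoc _ _ _
      _ = (Fintype.card G : ℂ) * ((B w w' : ℂ) * ∑ y, (F w y : ℂ) * (F w' y : ℂ)) := by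
          rw [h]
          ring
  calc (((Fintype.card G : ℝ) * ∑ w, ∑ w', B w w' * ∑ y, F w y * F w' y : ℝ) : ℂ)
      = (Fintype.card G : ℂ) * ∑ w, ∑ w', (B w w' : ℂ) * ∑ y, (F w y : ℂ) * (F w' y : ℂ) := by
        push_cast
        ring
    _ = ∑ w, ∑ w', ∑ ψ : AddChar G ℂ,
          (B w w' : ℂ) * conj (∑ y, (F w y : ℂ) * ψ y) * (∑ y, (F w' y : ℂ) * ψ y) := by
        rw [Finset.mul_sum]
        refine Finset.sum_congr rfl fun w _ => ?_
        rw [Finset.mul_sum]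
        refine Finset.sum_congr rfl fun w' _ => ?_
        rw [key w w']
    _ = ∑ w, ∑ ψ : AddChar G ℂ, ∑ w',
          (B w w' : ℂ) * conj (∑ y, (F w y : ℂ) * ψ y) * (∑ y, (F w' y : ℂ) * ψ y) :=
        Finset.sum_congr rfl fun w _ => Finset.sum_comm
    _ = ∑ ψ : AddChar G ℂ, ∑ w, ∑ w',
          (B w w' : ℂ) * conj (∑ y, (F w y : ℂ) * ψ y) * (∑ y, (F w' y : ℂ) * ψ y) :=
        Finset.sum_comm

/-- Real form of `energy_eq_sum`:
`|G| · Σ_{w,w'} B w w' Σ_y F_w y · F_{w'} y = Σ_ψ re (Σ_{w,w'} B w w' · conj (F̂_w ψ) · F̂_{w'} ψ)`. -/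
theorem energy_eq_re_sum (B : W → W → ℝ) (F : W → G → ℝ) :
    (Fintype.card G : ℝ) * ∑ w, ∑ w', B w w' * ∑ y, F w y * F w' y =
      ∑ ψ : AddChar G ℂ, (∑ w, ∑ w', (B w w' : ℂ) * conj (∑ y, (F w y : ℂ) * ψ y) *
        (∑ y, (F w' y : ℂ) * ψ y)).re := by
  rw [← Complex.re_sum, ← energy_eq_sum B F, Complex.ofReal_re]

/-- **The convolution on the Fourier side**: for `g_w = θ ∗ h_w`,
`Σ_{w,w'} B w w' · conj (ĝ_w ψ) · ĝ_{w'} ψ = ‖θ̂ ψ‖² · Σ_{w,w'} B w w' · conj (ĥ_w ψ) · ĥ_{w'} ψ`. -/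
theorem quad_ft_conv (B : W → W → ℝ) (h : W → G → ℝ) (θ : G → ℝ) (ψ : AddChar G ℂ) :
    ∑ w, ∑ w', (B w w' : ℂ) * conj (∑ y, ((∑ x, θ x * h w (y - x) : ℝ) : ℂ) * ψ y) *
        (∑ y, ((∑ x, θ x * h w' (y - x) : ℝ) : ℂ) * ψ y) =
      ((‖∑ x, (θ x : ℂ) * ψ x‖ ^ 2 : ℝ) : ℂ) *
        ∑ w, ∑ w', (B w w' : ℂ) * conj (∑ y, (h w y : ℂ) * ψ y) * (∑ y, (h w' y : ℂ) * ψ y) := by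
  have hc : ∀ w : W, ∑ y, ((∑ x, θ x * h w (y - x) : ℝ) : ℂ) * ψ y =
      (∑ x, (θ x : ℂ) * ψ x) * ∑ y, (h w y : ℂ) * ψ y := by
    intro w
    have e : ∑ y, (∑ x, (θ x : ℂ) * (h w (y - x) : ℂ)) * ψ y =
        (∑ x, (θ x : ℂ) * ψ x) * ∑ y, (h w y : ℂ) * ψ y :=
      ft_conv (fun x => (θ x : ℂ)) (fun y => (h w y : ℂ)) ψ
    rw [← e]
    push_cast
    rfl
  symm
  rw [Finset.mul_sum]
  refine Finset.sum_congr rfl fun w _ => ?_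
  rw [Finset.mul_sum]
  refine Finset.sum_congr rfl fun w' _ => ?_
  rw [hc w, hc w', mul_conj_mul_mul]

/-- **Convolution contracts the `B`-energy** (the content of `stub_thetaConvolutionBound`): for a real
kernel `B` on a finite `W` that is positive semidefinite as a real quadratic form, real functions `h w` on a
finite additive commutative group `G`, and a real `θ` whose character sums are bounded in norm by `M`,
`Σ_{w,w'} B w w' · Σ_y (θ ∗ h_w)(y) (θ ∗ h_{w'})(y) ≤ M² · Σ_{w,w'} B w w' · Σ_y h_w y · h_{w'} y`. -/
theorem conv_energy_le (B : W → W → ℝ) (h : W → G → ℝ) (θ : G → ℝ) (M : ℝ)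
    (hpsd : ∀ x : W → ℝ, 0 ≤ ∑ w, ∑ w', x w * B w w' * x w')
    (hM : ∀ ψ : AddChar G ℂ, ‖∑ x, (θ x : ℂ) * ψ x‖ ≤ M) :
    ∑ w, ∑ w', B w w' * ∑ y, (∑ x, θ x * h w (y - x)) * (∑ x, θ x * h w' (y - x)) ≤
      M ^ 2 * ∑ w, ∑ w', B w w' * ∑ y, h w y * h w' y := by
  have hN : (0 : ℝ) < Fintype.card G := by exact_mod_cast Fintype.card_pos
  have hL : (Fintype.card G : ℝ) *
      ∑ w, ∑ w', B w w' * ∑ y, (∑ x, θ x * h w (y - x)) * (∑ x, θ x * h w' (y - x)) =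
      ∑ ψ : AddChar G ℂ, ‖∑ x, (θ x : ℂ) * ψ x‖ ^ 2 *
        (∑ w, ∑ w', (B w w' : ℂ) * conj (∑ y, (h w y : ℂ) * ψ y) * (∑ y, (h w' y : ℂ) * ψ y)).re := by
    rw [energy_eq_re_sum B (fun w y => ∑ x, θ x * h w (y - x))]
    refine Finset.sum_congr rfl fun ψ _ => ?_
    rw [quad_ft_conv B h θ ψ, Complex.re_ofReal_mul]
  have hR := energy_eq_re_sum B h
  refine le_of_mul_le_mul_left ?_ hN
  rw [hL, mul_left_comm, hR]
  exact sum_mul_le_of_le _ _ _ _ (fun ψ _ => pow_le_pow_left₀ (norm_nonneg _) (hM ψ) 2)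
    (fun ψ _ => re_quad_conj_nonneg B hpsd _)

end Energy

/-- **Registered milestone stub `stub_thetaConvolutionBound`** (crux stmt-MatrixMultiplication-14309, line
clique-coclique-direct-sum-clique; milestone 5 of the bet `stub_thetaBound`, the one Fourier-analytic input of
the programme).  For a symmetric PSD real kernel `B` on a finite `W`, real functions `h w` on a finite additive
commutative group `G`, a real function `θ` on `G` whose character sums are bounded by `M`
(`‖Σ_x θ x ψ x‖ ≤ M` for every `ψ : AddChar G ℂ`), convolution by `θ` contracts the `B`-energy by `M²`:
`Σ_{w,w'} B w w' ⟨θ ∗ h_w, θ ∗ h_{w'}⟩ ≤ M² · Σ_{w,w'} B w w' ⟨h_w, h_{w'}⟩`, `(θ ∗ h)(y) = Σ_x θ x h (y − x)`.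
This is `conv_energy_le`; the symmetry hypothesis is carried for uniformity and not used. -/
theorem stub_thetaConvolutionBound :
    ∀ (G : Type) [AddCommGroup G] [Fintype G] [DecidableEq G] (W : Type) [Fintype W]
      (B : W → W → ℝ) (h : W → G → ℝ) (θ : G → ℝ) (M : ℝ),
      (∀ w w', B w w' = B w' w) →
      (∀ x : W → ℝ, 0 ≤ ∑ w, ∑ w', x w * B w w' * x w') →
      (∀ ψ : AddChar G ℂ, ‖∑ x, (θ x : ℂ) * ψ x‖ ≤ M) →
      ∑ w, ∑ w', B w w' * ∑ y, (∑ x, θ x * h w (y - x)) * (∑ x, θ x * h w' (y - x)) ≤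
        M ^ 2 * ∑ w, ∑ w', B w w' * ∑ y, h w y * h w' y :=
  fun G _ _ _ W _ B h θ M _ hpsd hM => conv_energy_le (G := G) (W := W) B h θ M hpsd hM

end Summit.MatrixMultiplication.MatrixMultiplication.Theorems.PrimeCyclicPowerGainTheta.Convolution
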